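import Mathlib
import Summits.Ventures.PercRepro2.Defs
import Summits.Ventures.PercRepro2.Graph
import Summits.Ventures.PercRepro2.OneColourSwitch
import Summits.Ventures.PercRepro2.RegionHubSign
import Summits.Ventures.PercRepro2.SideSwitch
import Summits.Ventures.PercRepro2.TermSwitchDefs
import Summits.Ventures.PercRepro2.TermSwitchReach
import Summits.Ventures.PercRepro2.M9NoPocketDefs
import Summits.Ventures.PercRepro2.M9Unreached
import Summits.Ventures.PercRepro2.M9GeneralDSplit
import Summits.Ventures.PercRepro2.M9PsiOneDefs
import Summits.Ventures.PercRepro2.M9PsiOneWorlds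
import Summits.Ventures.PercRepro2.M9PsiOneLink
import Summits.Ventures.PercRepro2.M9PsiOneInj
import Summits.Ventures.PercRepro2.M9PsiTwoDefs
import Summits.Ventures.PercRepro2.M9PsiTwoWorlds
import Summits.Ventures.PercRepro2.M9PsiTwoNoLink
import Summits.Ventures.PercRepro2.M9PsiTwoLink
import Summits.Ventures.PercRepro2.M9PsiTwoSigma

/-!
# The second partner `Ψ₂ ω` is a DIRTY one-sided `K`-point, and it pays (blind cell
PercRepro2, p3 g34, 2026-08-29; `proofs/P3-REST2.md` §1, claims (v) and the pointwise payment)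

For an `EX` colouring `ω` with `r ~_W s`, `r ≁_Y s` and no edge `r–s`: `d` has a `W`-neighbour
`x` rooted at a terminal inside its block (`exists_rooted_nbr_any`, from `d ∈ M₂(ω)`); the one
whose `d`-edge `Ψ₂` keeps is in `K₂(Ψ₂ ω)` and `W`-adjacent to `d` — a DEAD END
(`exists_dead_end`), so `Ψ₂ ω` is not `DZero_H` for `H = {r, s, d}` (`not_DZeroH_psiTwo`) and
**`Ψ₂ ω ∈ HD` with `d ∈ K₂`** (`HD_psiTwo`, `psiTwo_mem_HDK`).  With `σ_rs(Ψ₂ ω) = +1`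
(`M9PsiTwoLink`) and `σ_pq(Ψ₂ ω) ≤ σ_pq(ω)` (`M9PsiTwoSigma`): **the pointwise payment**
`σ_pq(ω) σ_rs(ω) + σ_pq(Ψ₂ ω) σ_rs(Ψ₂ ω) ≤ 0` (`psiTwo_term_nonpos`).  The injectivity of `Ψ₂`
(claim (iv)) and the summed payment are left to a successor file.  Own work; std axioms.
-/

namespace Summit.Ventures.PercRepro2

namespace NoPocket

open Finset Classical RegionHub OneColourSwitch SideSwitch TermSwitch

variable {V : Type*} {E : Type*}

section Dirty

variable {ends : E → Sym2 V} {p q r s d : V} {ω : Config E}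

/-- A vertex rooted at both terminals inside its block is `W`-linking. -/
lemma linkingW_of_rootedW_both {x : V} (hr : rootedW ends r s d ω r x)
    (hs : rootedW ends r s d ω s x) : linkingW ends r s d ω x :=
  ⟨hr.1, conn_trans hr.2 (conn_symm hs.2)⟩

variable (h : IsEX ends p q r s d ω)
include h

/-- **`d` has a `W`-neighbour rooted at a terminal inside its block** (from `d ∈ M₂(ω)`):
otherwise the rooted `W`-core vertices and the terminals would be closed under the closed
edges of `ω`, and `d` would not be in the `W`-world. -/
theorem exists_rooted_nbr_any :
    ∃ x e, (rootedW ends r s d ω r x ∨ rootedW ends r s d ω s x) ∧ ends e = s(x, d) ∧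
      ω e = false := by
  by_contra hno
  have hno' : ∀ x e, (rootedW ends r s d ω r x ∨ rootedW ends r s d ω s x) → ends e = s(x, d) →
      ω e = false → False := fun x e h1 h2 h3 => hno ⟨x, e, h1, h2, h3⟩
  have key : d ∈ {z | z = r ∨ z = s ∨ rootedW ends r s d ω r z ∨ rootedW ends r s d ω s z} := by
    have hdM := h.inM
    rcases mem_M2_iff.1 hdM with hc | hc
    · refine mem_of_conn_of_closed (ends := ends) ?_ (Or.inl rfl) hc
      exact closed_aux h hno'
    · refine mem_of_conn_of_closed (ends := ends) ?_ (Or.inr (Or.inl rfl)) hc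
      exact closed_aux h hno'
  rcases key with hk | hk | hk | hk
  · exact h.hr hk
  · exact h.hs hk
  · exact d_not_mem_Mcore hk.1
  · exact d_not_mem_Mcore hk.1
where
  /-- The closure step of `exists_rooted_nbr_any`. -/
  closed_aux (h : IsEX ends p q r s d ω)
      (hno' : ∀ x e, (rootedW ends r s d ω r x ∨ rootedW ends r s d ω s x) → ends e = s(x, d) →
        ω e = false → False) :
      ∀ x ∈ {z | z = r ∨ z = s ∨ rootedW ends r s d ω r z ∨ rootedW ends r s d ω s z}, ∀ y,
        (openGraph ends (OneColourSwitch.compl ω)).Adj x y →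
          y ∈ {z | z = r ∨ z = s ∨ rootedW ends r s d ω r z ∨ rootedW ends r s d ω s z} := by
    intro x hx y hxy
    obtain ⟨hne, e, he, hends⟩ := openGraph_adj.1 hxy
    have hω : ω e = false := by simpa [OneColourSwitch.compl] using he
    rcases vertex_cases (ends := ends) (r := r) (s := s) (d := d) (ω := ω) y with
      hy | hy | hy | hyK | hyM | hyO
    · exact Or.inl hy
    · exact Or.inr (Or.inl hy)
    · exfalso
      rcases hx with hx | hx | hx | hx
      · exact no_edge_d_term h (Or.inl hx) (ends_swap (hy ▸ hends))
      · exact no_edge_d_term h (Or.inr hx) (ends_swap (hy ▸ hends))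
      · exact hno' x e (Or.inl hx) (hy ▸ hends) hω
      · exact hno' x e (Or.inr hx) (hy ▸ hends) hω
    · exfalso
      rcases hx with hx | hx | hx | hx
      · rw [edge_Kcore_term h hyK (Or.inl hx) (ends_swap hends)] at hω
        exact Bool.false_ne_true hω.symm
      · rw [edge_Kcore_term h hyK (Or.inr hx) (ends_swap hends)] at hω
        exact Bool.false_ne_true hω.symm
      · exact no_edge_core_core h hyK hx.1 (ends_swap hends)
      · exact no_edge_core_core h hyK hx.1 (ends_swap hends)
    · rcases hx with hx | hx | hx | hx
      · refine Or.inr (Or.inr (Or.inl ⟨hyM, conn_of_openAdj ⟨e, ?_, hx ▸ hends⟩⟩))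
        rw [restrictTo_compl_eq (S := blockIn ends (Mcore ends r s d ω) y ∪ {r, s}) (by simp)
          (Or.inl (mem_blockIn_self _ _)) (hx ▸ hends), hω]
        rfl
      · refine Or.inr (Or.inr (Or.inr ⟨hyM, conn_of_openAdj ⟨e, ?_, hx ▸ hends⟩⟩))
        rw [restrictTo_compl_eq (S := blockIn ends (Mcore ends r s d ω) y ∪ {r, s}) (by simp)
          (Or.inl (mem_blockIn_self _ _)) (hx ▸ hends), hω]
        rfl
      · have hblk := blockIn_eq_of_Mcore_edge hx.1 hyM hends
        refine Or.inr (Or.inr (Or.inl ⟨hyM, ?_⟩))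
        rw [← hblk]
        refine conn_trans hx.2 (conn_of_openAdj ⟨e, ?_, hends⟩)
        rw [restrictTo_compl_eq (S := blockIn ends (Mcore ends r s d ω) x ∪ {r, s})
          (Or.inl (mem_blockIn_self _ _)) (Or.inl (hblk ▸ mem_blockIn_self _ _)) hends, hω]
        rfl
      · have hblk := blockIn_eq_of_Mcore_edge hx.1 hyM hends
        refine Or.inr (Or.inr (Or.inr ⟨hyM, ?_⟩))
        rw [← hblk]
        refine conn_trans hx.2 (conn_of_openAdj ⟨e, ?_, hends⟩)
        rw [restrictTo_compl_eq (S := blockIn ends (Mcore ends r s d ω) x ∪ {r, s})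
          (Or.inl (mem_blockIn_self _ _)) (Or.inl (hblk ▸ mem_blockIn_self _ _)) hends, hω]
        rfl
    · exfalso
      rcases hx with hx | hx | hx | hx
      · exact no_edge_out_term h hyO (Or.inl hx) hends
      · exact no_edge_out_term h hyO (Or.inr hx) hends
      · rw [edge_Mcore_out hx.1 hyO hends] at hω; exact Bool.false_ne_true hω.symm
      · rw [edge_Mcore_out hx.1 hyO hends] at hω; exact Bool.false_ne_true hω.symm

/-- **A dead end of `Ψ₂ ω`**: a `W`-neighbour of `d` in `Ψ₂ ω` lying in `K₂(Ψ₂ ω)` (no edge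
`r–s`, `r ~_W s` in `ω`). -/
theorem exists_dead_end (hrs : ∀ e, ends e ≠ s(r, s))
    (hc : Conn ends (OneColourSwitch.compl ω) r s) :
    ∃ x e, x ∈ Mcore ends r s d ω ∧ x ∈ K2 ends r s (psiTwo ends r s d ω) ∧ ends e = s(x, d) ∧
      psiTwo ends r s d ω e = false := by
  by_cases hp : PureW ends r s d ω
  · -- pure case: the neighbour rooted at the root of `d` keeps its `d`-edge
    by_cases hdr : Conn ends ω d r
    · have hopp : oppRoot ends r s d ω = s := by unfold oppRoot; rw [if_pos hdr]
      obtain ⟨x, e, hx, hends, hω⟩ := exists_rooted_nbr h hrs hp hc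
      have hxJ : x ∈ joinedW ends r s d ω := mem_joinedW_of_nbr hx.1 (ends_swap hends)
      refine ⟨x, e, hx.1, ?_, hends, ?_⟩
      · exact mem_K2_iff.2 (Or.inl (conn_psiTwo_of_rootedW h hrs (Or.inl hxJ) hx))
      · rw [psiTwo_d_joinedW_kept (ends_swap hends) (fun hs' => ?_), hω]
        rw [hopp] at hs'
        exact hp x (linkingW_of_rootedW_both hx hs')
    · have hopp : oppRoot ends r s d ω = r := by unfold oppRoot; rw [if_neg hdr]
      obtain ⟨x, e, hx, hends, hω⟩ := exists_rooted_nbr_s h hrs hp hc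
      have hxJ : x ∈ joinedW ends r s d ω := mem_joinedW_of_nbr hx.1 (ends_swap hends)
      refine ⟨x, e, hx.1, ?_, hends, ?_⟩
      · exact mem_K2_iff.2 (Or.inr (conn_psiTwo_of_rootedW h hrs (Or.inl hxJ) hx))
      · rw [psiTwo_d_joinedW_kept (ends_swap hends) (fun hr' => ?_), hω]
        rw [hopp] at hr'
        exact hp x (linkingW_of_rootedW_both hr' hx)
  · -- non-pure case: every edge at `d` is kept
    obtain ⟨x, e, hx, hends, hω⟩ := exists_rooted_nbr_any h
    have hxM : x ∈ Mcore ends r s d ω := by rcases hx with hx | hx <;> exact hx.1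
    have hxJ : x ∈ joinedW ends r s d ω := mem_joinedW_of_nbr hxM (ends_swap hends)
    refine ⟨x, e, hxM, ?_, hends, ?_⟩
    · rcases hx with hx | hx
      · exact mem_K2_iff.2 (Or.inl (conn_psiTwo_of_rootedW h hrs (Or.inl hxJ) hx))
      · exact mem_K2_iff.2 (Or.inr (conn_psiTwo_of_rootedW h hrs (Or.inl hxJ) hx))
    · rw [psiTwo_d_of_not_pure (ends_swap hends) hp, hω]

/-- **`Ψ₂ ω` is not `DZero_H` for `H = {r, s, d}`**: the dead end lies in both worlds of `H`. -/
theorem not_DZeroH_psiTwo (hrs : ∀ e, ends e ≠ s(r, s))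
    (hc : Conn ends (OneColourSwitch.compl ω) r s) :
    ¬ DZeroH ends ({r, s, d} : Set V) (psiTwo ends r s d ω) := by
  intro hD
  obtain ⟨x, e, hxM, hxK, hends, he⟩ := exists_dead_end h hrs hc
  have hxH : x ∉ ({r, s, d} : Set V) := by
    simp only [Set.mem_insert_iff, Set.mem_singleton_iff]
    rintro (rfl | rfl | rfl)
    · exact term_not_mem_Mcore (Or.inl rfl) hxM
    · exact term_not_mem_Mcore (Or.inr rfl) hxM
    · exact d_not_mem_Mcore hxM
  have hxKH : x ∈ KH ends ({r, s, d} : Set V) (psiTwo ends r s d ω) := by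
    rcases mem_K2_iff.1 hxK with hc' | hc'
    · exact ⟨r, by simp, hc'⟩
    · exact ⟨s, by simp, hc'⟩
  have hxMH : x ∈ MH ends ({r, s, d} : Set V) (psiTwo ends r s d ω) :=
    mem_MH_of_closed (mem_MH_of_mem (by simp) _) he (ends_swap hends)
  exact hD x hxH hxKH hxMH

/-- **`Ψ₂ ω ∈ HD`**: a dirty, reached `Sep ∧ DOne(d)` colouring (no edge `r–s`, `r ~_W s` in
`ω`). -/
theorem HD_psiTwo (hrs : ∀ e, ends e ≠ s(r, s))
    (hc : Conn ends (OneColourSwitch.compl ω) r s) : HD ends p q r s d (psiTwo ends r s d ω) :=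
  ⟨sep2_psiTwo h, DOne_psiTwo h, Or.inl (mem_K2_psiTwo h),
    fun h' => not_DZeroH_psiTwo h hrs hc h'.2⟩

/-- **`Ψ₂ ω` is a dirty one-sided `K`-point**: `HD` with `d ∈ K₂ ∖ M₂`. -/
theorem psiTwo_mem_HDK (hrs : ∀ e, ends e ≠ s(r, s))
    (hc : Conn ends (OneColourSwitch.compl ω) r s) :
    HD ends p q r s d (psiTwo ends r s d ω) ∧ d ∈ K2 ends r s (psiTwo ends r s d ω) ∧
      d ∉ M2 ends r s (psiTwo ends r s d ω) :=
  ⟨HD_psiTwo h hrs hc, mem_K2_psiTwo h, not_mem_M2_psiTwo h⟩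

/-- **THEOREM Ψ₂, pointwise**: a doubly-reached colouring with `σ_rs = −1` and its second
partner have a non-positive joint sign sum, `σ_pq(ω) σ_rs(ω) + σ_pq(Ψ₂ ω) σ_rs(Ψ₂ ω) ≤ 0`
(no edge `r–s`). -/
theorem psiTwo_term_nonpos (hrs : ∀ e, ends e ≠ s(r, s)) (hY : ¬ Conn ends ω r s)
    (hc : Conn ends (OneColourSwitch.compl ω) r s) :
    sigma ends ω p q * sigma ends ω r s +
      sigma ends (psiTwo ends r s d ω) p q * sigma ends (psiTwo ends r s d ω) r s ≤ 0 := by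
  have h1 : sigma ends ω r s = -1 := by
    unfold sigma; rw [if_neg hY, if_pos hc]; rfl
  rw [h1, sigma_psiTwo_rs h hrs hc, mul_one, mul_neg_one]
  have := sigma_psiTwo_pq_le h (p := p) (q := q)
  linarith

end Dirty

end NoPocket

end Summit.Ventures.PercRepro2
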